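import Summits.BirchSwinnertonDyer.Rank1Residual.AdditivePotMult.TwistPointsOver
import Literature.NumberTheory.EllipticCurves.KrizLi2019.SexticTwistBSDThreeDescent
import Literature.NumberTheory.EllipticCurves.BSDInvariantsRegulatorProofs
import HarnessLib

/-!
# Heights and the Heegner index when the rank lives in the TWIST: `m · #E(K)_tors² · ĥ_K(P) = 2 · [E(K):ℤP]² · Reg(E^{(d)}/ℚ)` for `rank E(ℚ) = 0`, `rank E(K) = 1` (cell `b2b-bsdres`, sub-cell additive-p1, gen 13)

HONEST FRAMING (cell `b2b-bsdres`, run/shared/lean/b2b/bsd-rank1-residual/, verbatim in every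
file): the goal of the cell is to DELETE the COMBINATION-SHAPED residual classes of the
Birch–Swinnerton-Dyer formula for ALL analytic-rank `≤ 1` elliptic curves over `ℚ` — "full BSD
formula for every rank `≤ 1` curve in class `C`" assembled STRICTLY from published theorems — so
that the rank-`≤ 1` remainder becomes exactly the CONSTRUCTION-SHAPED classes, which are TYPED
(missing-input `Prop`s), NOT attempted. This is not "finishing BSD". Sub-cell additive-p1 is a
RESEARCH ROUTE on X3♯(M) / X4(M); labels UNCHANGED; nothing booked.

THEOREMS ONLY (no definition, no named fact). Pure kernel algebra (no literature input beyond
the tree's height theory).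

## What this file records

The Gross–Zagier bookkeeping of the cell (`X11b.exists_shaAn_padicVal_eq_of_heegner`, multr1-p2;
Jetchev–Skinner–Wan 2017 (eq:gz for K′)) is stated for a curve `E/ℚ` of analytic rank ONE, the
Heegner twist `E^{(d_K)}` having rank zero; its height ingredient is Kriz–Li's
`exists_mul_canonicalHeight_eq_index_sq_mul_regulator`: for `rank E(K) = rank E(ℚ) = 1` and
`P ∈ E(K)` of infinite order, `m·#E(K)_tors²·ĥ_K(P) = 2·[E(K):ℤP]²·Reg(E/ℚ)`, `m ∈ {1,4}` — the
conjugation `σ` of `K/ℚ` acting as `+1` on `E(K)/tors`. For the RANK-ZERO cell E-ii of the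
RESIDUAL-MAP (X4(M) ∧ ¬Surj, `r_an(E) = 0`) the roles are swapped: `E(ℚ)` is finite, the rank of
`E(K)` comes from the twist `E^{(d)}(ℚ)` (`K = ℚ(√d)`), and `σ` acts as `−1` on `E(K)/tors`. This
file proves the corresponding identity

  `m · #E(K)_tors² · ĥ_K(P) = 2 · [E(K):ℤP]² · Reg(E^{(d)}/ℚ)`, `m ∈ {1, 4}`

(`exists_mul_canonicalHeight_eq_index_sq_mul_regulator_twist`), the first brick of the rank-zero
twin of the bookkeeping identity (which would turn the typed class-level upper half of E-ii into
"⇐ the LOWER half of a rank-one same-`j` twist", image-free). Tools: this sub-cell's gen-8 twist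
substitution `Φ_K : E^{(d)}(K) ≃+ E(K)` (`twistPointEquivOver`) with its ANTI-naturality under `σ`
(`map_twistPointEquivOver_of_neg`: `σΦ = −Φσ`), so that `ψ := Φ_K ∘ ι_d : E^{(d)}(ℚ) → E(K)` lands
in the `σ = −1` part and every `σ`-anti-fixed point of `E(K)` is in its image; the canonical height
is invariant under `Φ_K` (variable changes: `canonicalHeight_pointEquiv`; transports along equal
equations) and doubles under base change (`canonicalHeight_baseChange`).

* `canonicalHeight_congrEquiv`, `canonicalHeight_twistPointEquivOver` — height bookkeeping.
* `exists_mul_canonicalHeight_eq_index_sq_mul_regulator_twist` — the identity.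

References: [GrossZagier1986] V.§2 (p. 311); [JetchevSkinnerWan2017] §7.4.1; [SilvermanAEC2009]
VIII.9.1, X.5.4, Exercise 10.16; [KrizLi2019] §2 (shape).
-/

noncomputable section

open scoped Classical

-- The tree's point-group lemmas over a general field `F` carry the classical `DecidableEq F`
-- inside their statements; specialised to `F = ℚ` they meet Mathlib's `instDecidableEqRat` here.
-- Giving the classical instance priority in THIS file makes the two agree (no library instance
-- is changed; the attribute is local to this file).
attribute [local instance 2000] Classical.propDecidable

open WeierstrassCurve Literature.NumberTheory.EllipticCurves
  Literature.NumberTheory.EllipticCurves.KrizLi2019 Literature.NumberTheory.QuadraticFields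

namespace Summit.BirchSwinnertonDyer.Rank1Residual.AdditivePotMult

universe u

/-! ### §1 Height bookkeeping for the twist substitution -/

/-- Transport along an equality of Weierstrass equations preserves the canonical height (it is the
identity on coordinates). [folklore] -/
theorem canonicalHeight_congrEquiv {A : Type u} [Field A] [NumberField A]
    {W₁ W₂ : WeierstrassCurve A} (h : W₁ = W₂) (P : W₁.toAffine.Point) :
    (Affine.Point.congrEquiv h P).canonicalHeight = P.canonicalHeight := by
  subst h
  rfl

/-- **The twist substitution `Φ_A : E^{(c)}(A) ≃+ E(A)` preserves canonical heights** (over a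
number field `A ∋ t`, `t² = c`, `t ∉ ℚ`): `Φ_A` is a composite of admissible changes of variables
(`canonicalHeight_pointEquiv`, Silverman AEC VIII.9.1) and transports along equal equations.
[cite: SilvermanAEC2009, Prop. VIII.9.1] -/
theorem canonicalHeight_twistPointEquivOver (W : WeierstrassCurve ℚ) {A : Type u} [Field A]
    [NumberField A] {t : A} {c : ℚ} (ht : t ∉ Set.range (algebraMap ℚ A))
    (htc : t ^ 2 = algebraMap ℚ A c) (P : ((W.quadraticTwist c).baseChange A).toAffine.Point) :
    (twistPointEquivOver W ht htc P).canonicalHeight = P.canonicalHeight := by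
  rw [twistPointEquivOver_apply]
  -- step 1 preserves heights
  have h1 : (twistStepOne W ht htc P).canonicalHeight = P.canonicalHeight := by
    simp only [twistStepOne, AddEquiv.trans_apply]
    rw [canonicalHeight_congrEquiv, Affine.Point.canonicalHeight_pointEquiv]
  -- step 2 preserves heights, hence so does its inverse
  have h2 : ∀ Q : (W.baseChange A).toAffine.Point,
      (twistStepTwo W (A := A) Q).canonicalHeight = Q.canonicalHeight := by
    intro Q
    simp only [twistStepTwo, AddEquiv.trans_apply]
    rw [canonicalHeight_congrEquiv, Affine.Point.canonicalHeight_pointEquiv]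
  have h3 := h2 ((twistStepTwo W (A := A)).symm (twistStepOne W ht htc P))
  rw [AddEquiv.apply_symm_apply] at h3
  rw [← h3, h1]

/-! ### §2 The height–index identity with the regulator of the twist -/

/-- **Height–index relation for a point of infinite order when the rank lives in the twist.**
`W/ℚ` elliptic with `E(ℚ)` of rank `0`; `K = ℚ(θ)` quadratic, `θ² = d`, `θ ∉ ℚ`; the twist
`E^{(d)} = W.quadraticTwist d` of rank `1` over `ℚ`; `rank E(K) = 1`; `P ∈ E(K)` of infinite order.
Then `m · #E(K)_tors² · ĥ_K(P) = 2 · [E(K):ℤP]² · Reg(E^{(d)}/ℚ)` for some `m ∈ {1, 4}` (`ĥ_K` the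
canonical height over `K`, `Reg(E^{(d)}/ℚ) = ĥ_ℚ(g)` for a generator `g` of `E^{(d)}(ℚ)/tors`).
Proof (twin of Kriz–Li's `exists_mul_canonicalHeight_eq_index_sq_mul_regulator`, where `σ = +1`):
let `g_K` generate `E(K)/T`, `T` the torsion; the conjugation `σ` of `K/ℚ` preserves `T`, so
`σ g_K ≡ e·g_K`; `g_K + σ g_K` is `σ`-fixed, hence `ℚ`-rational (AEC Ex. 10.16), hence torsion
(`rank E(ℚ) = 0`), so `e = −1`; then `g_K − σ g_K ≡ 2 g_K` is `σ`-ANTI-fixed, hence of the form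
`ψ(y)`, `ψ = Φ_K ∘ ι_d : E^{(d)}(ℚ) → E(K)` (anti-naturality `σ Φ_K = −Φ_K σ` of the twist
substitution and `ℚ`-rationality of `σ`-fixed points of `E^{(d)}(K)`); with `ψ(g) ≡ k g_K` and
`y ≡ j g` this gives `jk = 2`, so `k² ∈ {1, 4}`; finally `ĥ_K(ψ g) = 2 ĥ_ℚ(g) = 2 Reg(E^{(d)})`
(heights are `Φ_K`-invariant and double under base change), `ĥ_K(P) = a² ĥ_K(g_K)` for
`P ≡ a g_K`, and `[E(K):ℤP] = |a|·#T`. [cite: GrossZagier1986, V.§2 (p. 311)]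
[cite: SilvermanAEC2009, Exercise 10.16 and Prop. VIII.9.1] -/
theorem exists_mul_canonicalHeight_eq_index_sq_mul_regulator_twist
    (W : WeierstrassCurve ℚ) [W.IsElliptic] (K : Type) [Field K] [NumberField K]
    (h2 : Module.finrank ℚ K = 2) {θ : K} {d : ℚ} (hθ : θ ∉ Set.range (algebraMap ℚ K))
    (hθd : θ ^ 2 = algebraMap ℚ K d) [(W.quadraticTwist d).IsElliptic]
    (hrK : (W.baseChange K).mordellWeilRank = 1) (hrQ : W.mordellWeilRank = 0)
    (hrd : (W.quadraticTwist d).mordellWeilRank = 1)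
    (P : (W.baseChange K).toAffine.Point) (hP : ¬ IsOfFinAddOrder P) :
    ∃ m : ℕ, (m = 1 ∨ m = 4) ∧
      (m : ℝ) * ((W.baseChange K).torsionOrder : ℝ) ^ 2 * P.canonicalHeight =
        2 * ((AddSubgroup.zmultiples P).index : ℝ) ^ 2 * (W.quadraticTwist d).regulator := by
  haveI : (W.baseChange K).IsElliptic := isElliptic_baseChange' W K
  haveI : ((W.quadraticTwist d).baseChange K).IsElliptic := isElliptic_baseChange' _ K
  haveI : NeZero (2 : ℚ) := ⟨two_ne_zero⟩
  -- generators over `K` (of `E`) and over `ℚ` (of the twist)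
  obtain ⟨gK, hgK, hgenK, huniqK, -⟩ :=
    exists_generator_regulator_eq_of_mordellWeilRank_eq_one (W.baseChange K) hrK
  obtain ⟨g, hg, hgen, huniq, hreg⟩ :=
    exists_generator_regulator_eq_of_mordellWeilRank_eq_one (W.quadraticTwist d) hrd
  set T := AddCommGroup.torsion (W.baseChange K).toAffine.Point with hT_def
  -- the twist map `ψ = Φ_K ∘ ι_d : E^{(d)}(ℚ) → E(K)` and the conjugation `σ`
  set Φ := twistPointEquivOver W (A := K) hθ hθd with hΦ_def
  set ιd := QuadraticDescent.incl K (W.quadraticTwist d) with hιd_def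
  -- the twist map `ψ y := Φ (ιd y)` (kept as a composite expression)
  set σ : (W.baseChange K).toAffine.Point →+ (W.baseChange K).toAffine.Point :=
    Affine.Point.map (W' := W) (Quadratic.conj h2 hθ hθd) with hσ_def
  set σd : ((W.quadraticTwist d).baseChange K).toAffine.Point →+
      ((W.quadraticTwist d).baseChange K).toAffine.Point :=
    Affine.Point.map (W' := W.quadraticTwist d) (Quadratic.conj h2 hθ hθd) with hσd_def
  have hσσ : ∀ x, σ (σ x) = x := fun x =>
    QuadraticDescent.conjMap_conjMap W (Quadratic.conj_conj h2 hθ hθd) x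
  have hσdι : ∀ y, σd (ιd y) = ιd y := fun y =>
    Affine.Point.map_baseChange (W' := W.quadraticTwist d) (Quadratic.conj h2 hθ hθd) y
  -- anti-naturality: `σ (Φ x) = −Φ (σd x)`
  have hanti : ∀ x, σ (Φ x) = -Φ (σd x) := fun x =>
    map_twistPointEquivOver_of_neg W hθ hθd hθ hθd (Quadratic.conj h2 hθ hθd)
      (Quadratic.conj_gen h2 hθ hθd) x
  have hσψ : ∀ y, σ (Φ (ιd y)) = -Φ (ιd y) := by
    intro y; rw [hanti, hσdι]
  -- `σ`-ANTI-fixed points of `E(K)` come from the twist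
  have hrange : ∀ R : (W.baseChange K).toAffine.Point, σ R = -R → ∃ y, Φ (ιd y) = R := by
    intro R hR
    set x := Φ.symm R with hx
    have hΦx : Φ x = R := Φ.apply_symm_apply R
    have hfix : σd x = x := by
      apply Φ.injective
      have := hanti x
      rw [hΦx, hR] at this
      -- `-R = -Φ (σd x)`
      have h' : Φ (σd x) = R := neg_injective this.symm
      rw [h', hΦx]
    obtain ⟨y, hy⟩ := AddMonoidHom.mem_range.mp
      (mem_range_incl_of_map_conj_eq (W.quadraticTwist d) K h2 hθ hθd x hfix)
    exact ⟨y, by rw [show ιd y = x from hy, hΦx]⟩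
  -- `σ` preserves torsion, hence respects congruences modulo `T`
  have hσT : ∀ {x y : (W.baseChange K).toAffine.Point}, x - y ∈ T → σ x - σ y ∈ T := by
    intro x y hxy
    rw [← map_sub]
    exact (AddCommGroup.mem_torsion _).mpr (σ.isOfFinAddOrder ((AddCommGroup.mem_torsion _).mp hxy))
  -- coefficients: `P ≡ a gK`, `ψ g ≡ k gK`, `σ gK ≡ e gK`
  obtain ⟨a, ha⟩ := hgenK P
  obtain ⟨k, hk⟩ := hgenK (Φ (ιd g))
  obtain ⟨e, he⟩ := hgenK (σ gK)
  have hcoef : ∀ {x : (W.baseChange K).toAffine.Point} {u v : ℤ},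
      x - u • gK ∈ T → x - v • gK ∈ T → u = v := by
    intro x u v hu hv
    have hmem : (u - v) • gK ∈ T := by
      have : (u - v) • gK = (x - v • gK) - (x - u • gK) := by rw [sub_smul]; abel
      rw [this]; exact T.sub_mem hv hu
    have := huniqK (u - v) hmem
    linarith
  have ha0 : a ≠ 0 := by
    rintro rfl
    rw [zero_smul, sub_zero] at ha
    exact hP ((AddCommGroup.mem_torsion _).mp ha)
  have hψg : ¬ IsOfFinAddOrder (Φ (ιd g)) := fun hfin =>
    hg ((QuadraticDescent.incl_injective (K := K) (W.quadraticTwist d)).isOfFinAddOrder_iff.mp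
      ((Function.Injective.isOfFinAddOrder_iff (f := Φ.toAddMonoidHom) Φ.injective).mp hfin))
  have hk0 : k ≠ 0 := by
    rintro rfl
    rw [zero_smul, sub_zero] at hk
    exact hψg ((AddCommGroup.mem_torsion _).mp hk)
  -- `e = -1`: `gK + σ gK` is `σ`-fixed, hence `ℚ`-rational, hence torsion (`rank E(ℚ) = 0`)
  have he1 : e = -1 := by
    have hfix : σ (gK + σ gK) = gK + σ gK := by rw [map_add, hσσ, add_comm]
    obtain ⟨y0, hy0⟩ := AddMonoidHom.mem_range.mp (mem_range_incl_of_map_conj_eq W K h2 hθ hθd _ hfix)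
    haveI : Finite W.toAffine.Point := W.mordellWeilRank_eq_zero_iff_holds.mp hrQ
    have hy0fin : IsOfFinAddOrder y0 := isOfFinAddOrder_of_finite y0
    have htor : gK + σ gK ∈ T := by
      rw [← hy0]
      exact (AddCommGroup.mem_torsion _).mpr ((QuadraticDescent.incl K W).isOfFinAddOrder hy0fin)
    -- `gK + σ gK ≡ (1 + e) gK`
    have h1e : (gK + σ gK) - (1 + e) • gK ∈ T := by
      have : (gK + σ gK) - (1 + e) • gK = σ gK - e • gK := by rw [add_smul, one_smul]; abel
      rw [this]; exact he
    have h0 : (gK + σ gK) - (0 : ℤ) • gK ∈ T := by rw [zero_smul, sub_zero]; exact htor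
    have := hcoef h1e h0
    linarith
  -- `gK - σ gK` is anti-fixed and `≡ 2 gK`
  have hantifix : σ (gK - σ gK) = -(gK - σ gK) := by rw [map_sub, hσσ]; abel
  obtain ⟨y, hy⟩ := hrange _ hantifix
  obtain ⟨j, hj⟩ := hgen y
  have hy1 : Φ (ιd y) - (j * k) • gK ∈ T := by
    have hA : Φ (ιd y) - j • Φ (ιd g) ∈ T := by
      have := Φ.toAddMonoidHom.isOfFinAddOrder (ιd.isOfFinAddOrder ((AddCommGroup.mem_torsion _).mp hj))
      rw [map_sub, map_zsmul, AddEquiv.coe_toAddMonoidHom, map_sub, map_zsmul] at this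
      exact (AddCommGroup.mem_torsion _).mpr this
    have hB : j • Φ (ιd g) - (j * k) • gK ∈ T := by
      have : j • Φ (ιd g) - (j * k) • gK = j • (Φ (ιd g) - k • gK) := by rw [mul_smul, smul_sub]
      rw [this]; exact T.zsmul_mem hk j
    have : Φ (ιd y) - (j * k) • gK = (Φ (ιd y) - j • Φ (ιd g)) + (j • Φ (ιd g) - (j * k) • gK) := by
      abel
    rw [this]; exact T.add_mem hA hB
  have hy2 : Φ (ιd y) - (2 : ℤ) • gK ∈ T := by
    rw [hy]
    have : gK - σ gK - (2 : ℤ) • gK = -(σ gK - e • gK) := by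
      rw [he1, two_zsmul, neg_one_zsmul]; abel
    rw [this]; exact T.neg_mem he
  have hjk : j * k = 2 := hcoef hy1 hy2
  have hk2 : k ^ 2 = 1 ∨ k ^ 2 = 4 := by
    have hkdvd : k ∣ 2 := ⟨j, by rw [mul_comm]; exact hjk.symm⟩
    have hkabs : k.natAbs ∣ 2 := by exact_mod_cast Int.natAbs_dvd_natAbs.mpr hkdvd
    have hle : k.natAbs ≤ 2 := Nat.le_of_dvd two_pos hkabs
    have hpos : 0 < k.natAbs := Int.natAbs_pos.mpr hk0
    have hsq : k ^ 2 = (k.natAbs : ℤ) ^ 2 := (Int.natAbs_sq k).symm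
    interval_cases h : k.natAbs
    · left; rw [hsq]; norm_num
    · right; rw [hsq]; norm_num
  -- heights
  have hhP : P.canonicalHeight = (a : ℝ) ^ 2 * gK.canonicalHeight :=
    canonicalHeight_eq_of_sub_zsmul_mem_torsion (W.baseChange K) ha
  have hhg : (Φ (ιd g)).canonicalHeight = (k : ℝ) ^ 2 * gK.canonicalHeight :=
    canonicalHeight_eq_of_sub_zsmul_mem_torsion (W.baseChange K) hk
  have hhg2 : (Φ (ιd g)).canonicalHeight = 2 * g.canonicalHeight := by
    rw [hΦ_def, canonicalHeight_twistPointEquivOver]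
    have h := Affine.Point.canonicalHeight_baseChange (R := ℚ) (K := ℚ) (L := K)
      (W := W.quadraticTwist d) g
    rw [h2] at h
    exact_mod_cast h
  -- index
  have hidx : (AddSubgroup.zmultiples P).index = a.natAbs * (W.baseChange K).torsionOrder :=
    index_zmultiples_eq (W.baseChange K) hgK hgenK ha0 ha
  refine ⟨(k ^ 2).toNat, ?_, ?_⟩
  · rcases hk2 with h | h <;> simp [h]
  · have hcast : (((k ^ 2).toNat : ℕ) : ℝ) = (k : ℝ) ^ 2 := by
      have : ((k ^ 2).toNat : ℤ) = k ^ 2 := Int.toNat_of_nonneg (sq_nonneg k)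
      exact_mod_cast this
    rw [hcast, hidx, hreg, hhP]
    have hasq : ((a.natAbs : ℕ) : ℝ) ^ 2 = (a : ℝ) ^ 2 := by
      rw [Nat.cast_natAbs, Int.cast_abs, sq_abs]
    push_cast
    rw [mul_pow]
    have key : (k : ℝ) ^ 2 * gK.canonicalHeight = 2 * g.canonicalHeight := by rw [← hhg, hhg2]
    calc (k : ℝ) ^ 2 * ((W.baseChange K).torsionOrder : ℝ) ^ 2 * ((a : ℝ) ^ 2 * gK.canonicalHeight)
        = ((W.baseChange K).torsionOrder : ℝ) ^ 2 * (a : ℝ) ^ 2 *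
            ((k : ℝ) ^ 2 * gK.canonicalHeight) := by ring
      _ = 2 * ((a.natAbs : ℝ) ^ 2 * ((W.baseChange K).torsionOrder : ℝ) ^ 2) *
            g.canonicalHeight := by rw [key, hasq]; ring

end Summit.BirchSwinnertonDyer.Rank1Residual.AdditivePotMult

end
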